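import Summits.QuantumFields.BalabanUV.Beta.D1BFx.SliceTransferDefectWard

/-!
# `BalabanUV.Beta.D1BFx.SliceTransferDefectWardJetMix` — road «BF-x» for binder row D1, slot (K), row **(K8-L) «NON-LOCAL REDUCTION»**, PART 2e:
# THE FIRST AND THE MIXED SECOND JET OF THE DEFECT IN CLOSED FORM THROUGH THE WARD FAILURES `E• = (KW)•`, FOR ANY SYMMETRIC WEIGHT —
# the exact second-order price of a Ward failure in the sharp∕weighted slice transfer (owner FINDING F-g8-2 §1 «`D_st` analogous … the model
# file will carry it»)

HONEST DEPENDENCY (cell records, verbatim): «continuum YM on T⁴ ⇐ BetaPertH ∧ nine spine estimates (0/9 proved); BetaPertH ⇐ (D1) ∧ (D4) ∧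
CAP+tail; G-an2-4 gates asym, D1 and NE2/3/4.»  HONEST FRAMING (cell contract, verbatim): «discharging `BetaPertH` makes Bałaban's UV stability
UNCONDITIONAL — a real constructive-QFT result; it is NOT the continuum limit and NOT the Clay problem.»  THIS MODULE DISCHARGES NOTHING of (K),
of D1 or of the wall: [folklore] finite-dimensional jet algebra over PARTS 1∕2a∕2c (`SliceTransferDefect`, `SliceTransferDefectJets`,
`SliceTransferDefectWard`) BY NAME.  No definition, no `def … : Prop`, nothing cited, no wall binder instantiated, 0 sorry.  It does NOT decide
whether Bałaban's typed literal has `E• = 0` («WARD-L», the row's letter owners' Q1); it prices NON-zero `E•` exactly through order 2.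
NOT D1, NOT BetaPertH, NOT continuum, NOT Clay.

ABSOLUTE RULE (cell charter, verbatim): «No internally-minted statement may enter as a cited fact. Every hypothesis is either kernel-proved in this
package or a verbatim quotation of a PUBLISHED theorem with page reference. The manuscript(s) under audit are NOT citable for their own disputed
steps — they are the thing under adjudication; programme-internal (2001/route/tribunal) claims are never citable.»

THE STATEMENTS.  Symmetric form jets `K•`, symmetric weight jets `B•` (ANY — no co-frame ∕ rank structure), gauge-mode jets `W•`; ONLY the
order-0 Ward letter `K₀W₀ = 0` (so that `Wᵀ(K+B)W = WᵀBW` at order 0).  Named by hypothesis-equations (instantiate with `rfl`): the Ward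
failures `Eₛ = KₛW₀ + K₀Wₛ`, `Eₜ`, `Eₛₜ = KₛₜW₀ + KₛWₜ + KₜWₛ + K₀Wₛₜ`; their Gram shadows `Zₛ = W₀ᵀEₛ`, `Zₜ`, `Zₛₜ = WₛᵀEₜ + WₜᵀEₛ + W₀ᵀEₛₜ`
(the jets of `WᵀKW`, PART 2c `gram₁∕gramMix_eq_ward`); the weight's data `Fₛ = BₛW₀ + B₀Wₛ`, `Fₜ` (jets of `BW`), `Φₛ = gram₁ W₀ Wₛ B₀ Bₛ`, `Φₜ`,
`Φₛₜ = gramMix W… B…` (jets of `WᵀBW`), `P = (gram₀ W₀ B₀)⁻¹`, `𝒫₀ = B₀W₀P`.  Then (PART 2a's deflated jets `deflJet•`, `= (K + defect K B W)•`):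

  deflJet₁ (K₀+B₀) (Kₛ+Bₛ) W₀ Wₛ = Kₛ + deflJet₁ B₀ Bₛ W₀ Wₛ − (Eₛ𝒫₀ᵀ + 𝒫₀Eₛᵀ) + 𝒫₀Zₛ𝒫₀ᵀ                        (`deflJet₁_add_eq_wardFailure`)
  deflJetMix (K+B)• W• = Kₛₜ + deflJetMix B• W• − g′(a₀)·e_st − g″(a₀)(e_s, a_t) − g″(a₀)(a_s, e_t) − g″(a₀)(e_s, e_t)   (`deflJetMix_add_eq_wardFailure`)

the second written out as 27 terms: `g(F, Φ) := FΦ⁻¹Fᵀ` at `a₀ = (B₀W₀, Φ₀)`, `g′(a₀)(δF, δΦ) = δF𝒫₀ᵀ + 𝒫₀δFᵀ − 𝒫₀δΦ𝒫₀ᵀ`,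
`g″(a₀)((δF,δΦ),(δF′,δΦ′)) = δFPδF′ᵀ + δF′PδFᵀ − δFPδΦ′𝒫₀ᵀ − 𝒫₀δΦ′PδFᵀ − δF′PδΦ𝒫₀ᵀ − 𝒫₀δΦPδF′ᵀ + 𝒫₀δΦPδΦ′𝒫₀ᵀ + 𝒫₀δΦ′PδΦ𝒫₀ᵀ`,
`e• = (E•, Z•)`, `a• = (F•, Φ•)`.  Every term carries a Ward failure; with a co-frame (rank-`|ρ|`) weight `deflJet• B W = 0` (PART 2c) and the
statements give the defect jets `D•` outright (`…_coframe` corollaries; PART 2d is the first-order co-frame case).  The identities are FREE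
polynomial identities in the atoms after the order-0 letter (the seat's free-algebra normaliser `ncexpand3/4.py` found residual 0 with
98 + 28 + 69 monomials); the Lean proof is one expansion + `abel`, no inverse bookkeeping.
Provenance: D1 formalisation swarm leaf seat `b2b-balaban-beta-d1-formalise-leaf-04` gen 8 (claim «D1-BFx-K8L» PART 2, cut (ii) by the road
owner `b2b-balaban-beta-d1-p2` gen 8; «(c4)» of the seat's statement line), 2026-08-21.
-/

noncomputable section

namespace Summit.QuantumFields.BalabanUV.Beta.D1BFx.SliceTransferDefectWardJetMix

open Matrix
open Summit.QuantumFields.BalabanUV.Beta.D1BFx.GramWeightJets (gram₀ gram₁)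
open Summit.QuantumFields.BalabanUV.Beta.D1BFx.GramWeightJetsMixed (gramMix)
open Summit.QuantumFields.BalabanUV.Beta.D1BFx.SliceTransferDefect (gram_add_of_ward)
open Summit.QuantumFields.BalabanUV.Beta.D1BFx.SliceTransferDefectJets
open Summit.QuantumFields.BalabanUV.Beta.D1BFx.SliceTransferDefectWard

variable {ν ρ : Type*} [Fintype ν] [Fintype ρ] [DecidableEq ρ]

/-! ## §1 First order -/

/-- [folklore] **THE FIRST DEFLATED JET OF `K + B` THROUGH THE WARD FAILURE, ANY SYMMETRIC WEIGHT** (`K₀W₀ = 0` only):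
`deflJet₁ (K₀+B₀) (Kₛ+Bₛ) W₀ Wₛ = Kₛ + deflJet₁ B₀ Bₛ W₀ Wₛ − (Eₛ·𝒫₀ᵀ + 𝒫₀·Eₛᵀ) + 𝒫₀·Zₛ·𝒫₀ᵀ`, `Eₛ = KₛW₀ + K₀Wₛ`, `Zₛ = W₀ᵀEₛ`, `P = (gram₀ W₀ B₀)⁻¹`,
`𝒫₀ = B₀W₀P`. -/
theorem deflJet₁_add_eq_wardFailure (K₀ Kₛ B₀ Bₛ : Matrix ν ν ℝ) (W₀ Wₛ : Matrix ν ρ ℝ) (Eₛ P₀ : Matrix ν ρ ℝ) (P Zₛ : Matrix ρ ρ ℝ)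
    (hK₀ : K₀ᵀ = K₀) (hKₛ : Kₛᵀ = Kₛ) (hB₀ : B₀ᵀ = B₀) (hBₛ : Bₛᵀ = Bₛ) (a0 : K₀ * W₀ = 0)
    (hEₛ : Eₛ = Kₛ * W₀ + K₀ * Wₛ) (hZₛ : Zₛ = W₀ᵀ * Eₛ) (hP : P = (gram₀ W₀ B₀)⁻¹) (hP₀ : P₀ = B₀ * W₀ * P) :
    deflJet₁ (K₀ + B₀) (Kₛ + Bₛ) W₀ Wₛ = Kₛ + deflJet₁ B₀ Bₛ W₀ Wₛ - (Eₛ * P₀ᵀ + P₀ * Eₛᵀ) + P₀ * Zₛ * P₀ᵀ := by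
  have hWK : W₀ᵀ * K₀ = 0 := by
    have := congrArg Matrix.transpose a0
    rwa [Matrix.transpose_mul, hK₀, Matrix.transpose_zero] at this
  have h1 : W₀ᵀ * (K₀ + B₀) = W₀ᵀ * B₀ := by rw [Matrix.mul_add, hWK, zero_add]
  have h2 : gram₀ W₀ (K₀ + B₀) = gram₀ W₀ B₀ := gram_add_of_ward B₀ W₀ a0
  have h3 : coT₁ W₀ Wₛ (K₀ + B₀) (Kₛ + Bₛ) = Eₛᵀ + coT₁ W₀ Wₛ B₀ Bₛ := by
    rw [coT₁_add_weight, coT₁_eq_ward W₀ Wₛ K₀ Kₛ, hKₛ, hK₀, hEₛ]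
  have h4 : gram₁ W₀ Wₛ (K₀ + B₀) (Kₛ + Bₛ) = Zₛ + gram₁ W₀ Wₛ B₀ Bₛ := by
    rw [gram₁_add_weight, gram₁_eq_ward W₀ Wₛ K₀ Kₛ, a0, Matrix.mul_zero, zero_add, hZₛ, hEₛ]
  have hPt : Pᵀ = P := by rw [hP, transpose_nonsing_inv, gram₀_transpose_of_symm B₀ W₀ hB₀]
  simp only [deflJet₁, invJet₁]
  rw [h1, h2, h3, h4, ← hP]
  subst hZₛ hEₛ hP₀
  simp only [gram₁, coT₁, Matrix.transpose_add, Matrix.transpose_mul, Matrix.transpose_transpose, hK₀, hKₛ, hB₀, hBₛ, hPt,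
    Matrix.mul_add, Matrix.add_mul, Matrix.neg_mul, Matrix.mul_neg, Matrix.mul_assoc]
  abel

/-! ## §2 Mixed second order -/

/-- [folklore] **THE MIXED DEFLATED JET OF `K + B` THROUGH THE WARD FAILURES, ANY SYMMETRIC WEIGHT** (`K₀W₀ = 0` only): with the named data of
the module docstring, `deflJetMix (K+B)• W• = Kₛₜ + deflJetMix B• W• − g′(a₀)·e_st − g″(a₀)(e_s, a_t) − g″(a₀)(a_s, e_t) − g″(a₀)(e_s, e_t)`
(27 terms, each carrying a Ward failure). -/
theorem deflJetMix_add_eq_wardFailure (K₀ Kₛ Kₜ Kₛₜ B₀ Bₛ Bₜ Bₛₜ : Matrix ν ν ℝ) (W₀ Wₛ Wₜ Wₛₜ : Matrix ν ρ ℝ)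
    (Eₛ Eₜ Eₛₜ Fₛ Fₜ P₀ : Matrix ν ρ ℝ) (P Φₛ Φₜ Φₛₜ Zₛ Zₜ Zₛₜ : Matrix ρ ρ ℝ)
    (hK₀ : K₀ᵀ = K₀) (hKₛ : Kₛᵀ = Kₛ) (hKₜ : Kₜᵀ = Kₜ) (hKₛₜ : Kₛₜᵀ = Kₛₜ)
    (hB₀ : B₀ᵀ = B₀) (hBₛ : Bₛᵀ = Bₛ) (hBₜ : Bₜᵀ = Bₜ) (hBₛₜ : Bₛₜᵀ = Bₛₜ) (a0 : K₀ * W₀ = 0)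
    (hEₛ : Eₛ = Kₛ * W₀ + K₀ * Wₛ) (hEₜ : Eₜ = Kₜ * W₀ + K₀ * Wₜ) (hEₛₜ : Eₛₜ = Kₛₜ * W₀ + Kₛ * Wₜ + Kₜ * Wₛ + K₀ * Wₛₜ)
    (hFₛ : Fₛ = Bₛ * W₀ + B₀ * Wₛ) (hFₜ : Fₜ = Bₜ * W₀ + B₀ * Wₜ)
    (hP : P = (gram₀ W₀ B₀)⁻¹) (hP₀ : P₀ = B₀ * W₀ * P)
    (hΦₛ : Φₛ = gram₁ W₀ Wₛ B₀ Bₛ) (hΦₜ : Φₜ = gram₁ W₀ Wₜ B₀ Bₜ) (hΦₛₜ : Φₛₜ = gramMix W₀ Wₛ Wₜ Wₛₜ B₀ Bₛ Bₜ Bₛₜ)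
    (hZₛ : Zₛ = W₀ᵀ * Eₛ) (hZₜ : Zₜ = W₀ᵀ * Eₜ) (hZₛₜ : Zₛₜ = Wₛᵀ * Eₜ + Wₜᵀ * Eₛ + W₀ᵀ * Eₛₜ) :
    deflJetMix (K₀ + B₀) (Kₛ + Bₛ) (Kₜ + Bₜ) (Kₛₜ + Bₛₜ) W₀ Wₛ Wₜ Wₛₜ
      = Kₛₜ + deflJetMix B₀ Bₛ Bₜ Bₛₜ W₀ Wₛ Wₜ Wₛₜ
        - (Eₛₜ * P₀ᵀ + P₀ * Eₛₜᵀ - P₀ * Zₛₜ * P₀ᵀ)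
        - (Eₛ * P * Fₜᵀ + Fₜ * P * Eₛᵀ - Eₛ * P * Φₜ * P₀ᵀ - P₀ * Φₜ * P * Eₛᵀ - Fₜ * P * Zₛ * P₀ᵀ - P₀ * Zₛ * P * Fₜᵀ
            + P₀ * Zₛ * P * Φₜ * P₀ᵀ + P₀ * Φₜ * P * Zₛ * P₀ᵀ)
        - (Fₛ * P * Eₜᵀ + Eₜ * P * Fₛᵀ - Fₛ * P * Zₜ * P₀ᵀ - P₀ * Zₜ * P * Fₛᵀ - Eₜ * P * Φₛ * P₀ᵀ - P₀ * Φₛ * P * Eₜᵀ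
            + P₀ * Φₛ * P * Zₜ * P₀ᵀ + P₀ * Zₜ * P * Φₛ * P₀ᵀ)
        - (Eₛ * P * Eₜᵀ + Eₜ * P * Eₛᵀ - Eₛ * P * Zₜ * P₀ᵀ - P₀ * Zₜ * P * Eₛᵀ - Eₜ * P * Zₛ * P₀ᵀ - P₀ * Zₛ * P * Eₜᵀ
            + P₀ * Zₛ * P * Zₜ * P₀ᵀ + P₀ * Zₜ * P * Zₛ * P₀ᵀ) := by
  have hWK : W₀ᵀ * K₀ = 0 := by
    have := congrArg Matrix.transpose a0
    rwa [Matrix.transpose_mul, hK₀, Matrix.transpose_zero] at this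
  have h1 : W₀ᵀ * (K₀ + B₀) = W₀ᵀ * B₀ := by rw [Matrix.mul_add, hWK, zero_add]
  have h2 : gram₀ W₀ (K₀ + B₀) = gram₀ W₀ B₀ := gram_add_of_ward B₀ W₀ a0
  have h3s : coT₁ W₀ Wₛ (K₀ + B₀) (Kₛ + Bₛ) = Eₛᵀ + coT₁ W₀ Wₛ B₀ Bₛ := by
    rw [coT₁_add_weight, coT₁_eq_ward W₀ Wₛ K₀ Kₛ, hKₛ, hK₀, hEₛ]
  have h3t : coT₁ W₀ Wₜ (K₀ + B₀) (Kₜ + Bₜ) = Eₜᵀ + coT₁ W₀ Wₜ B₀ Bₜ := by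
    rw [coT₁_add_weight, coT₁_eq_ward W₀ Wₜ K₀ Kₜ, hKₜ, hK₀, hEₜ]
  have h3st : coTMix W₀ Wₛ Wₜ Wₛₜ (K₀ + B₀) (Kₛ + Bₛ) (Kₜ + Bₜ) (Kₛₜ + Bₛₜ) = Eₛₜᵀ + coTMix W₀ Wₛ Wₜ Wₛₜ B₀ Bₛ Bₜ Bₛₜ := by
    rw [coTMix_add_weight, coTMix_eq_ward W₀ Wₛ Wₜ Wₛₜ K₀ Kₛ Kₜ Kₛₜ, hKₛₜ, hKₛ, hKₜ, hK₀, hEₛₜ]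
  have h4s : gram₁ W₀ Wₛ (K₀ + B₀) (Kₛ + Bₛ) = Zₛ + Φₛ := by
    rw [gram₁_add_weight, gram₁_eq_ward W₀ Wₛ K₀ Kₛ, a0, Matrix.mul_zero, zero_add, hZₛ, hEₛ, hΦₛ]
  have h4t : gram₁ W₀ Wₜ (K₀ + B₀) (Kₜ + Bₜ) = Zₜ + Φₜ := by
    rw [gram₁_add_weight, gram₁_eq_ward W₀ Wₜ K₀ Kₜ, a0, Matrix.mul_zero, zero_add, hZₜ, hEₜ, hΦₜ]
  have h4st : gramMix W₀ Wₛ Wₜ Wₛₜ (K₀ + B₀) (Kₛ + Bₛ) (Kₜ + Bₜ) (Kₛₜ + Bₛₜ) = Zₛₜ + Φₛₜ := by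
    rw [gramMix_add_weight, gramMix_eq_ward W₀ Wₛ Wₜ Wₛₜ K₀ Kₛ Kₜ Kₛₜ, a0, Matrix.mul_zero, zero_add, hZₛₜ, hEₛ, hEₜ, hEₛₜ, hΦₛₜ]
  have hPt : Pᵀ = P := by rw [hP, transpose_nonsing_inv, gram₀_transpose_of_symm B₀ W₀ hB₀]
  simp only [deflJetMix, invJet₁, invJetMix]
  rw [h1, h2, h3s, h3t, h3st, h4s, h4t, h4st, ← hΦₛ, ← hΦₜ, ← hΦₛₜ, ← hP]
  subst hZₛ hZₜ hZₛₜ hEₛ hEₜ hEₛₜ hFₛ hFₜ hP₀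
  simp only [gramMix, coT₁, coTMix, Matrix.transpose_add, Matrix.transpose_mul, Matrix.transpose_transpose, hK₀, hKₛ, hKₜ, hKₛₜ,
    hB₀, hBₛ, hBₜ, hBₛₜ, hPt, Matrix.mul_add, Matrix.add_mul, Matrix.neg_mul, Matrix.mul_neg, Matrix.sub_mul, Matrix.mul_sub,
    Matrix.mul_assoc]
  abel

/-! ## §3 Co-frame (rank-`|ρ|`) weights: the defect jets outright -/

/-- [folklore] **THE MIXED JET OF THE DEFECT FOR A CO-FRAME WEIGHT** `B• = gram•(T, A)` (symmetric `A•`; `T₀W₀`, `A₀` invertible): PART 2c's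
`deflJetMix_coframe` kills `deflJetMix B• W•`, so `deflJetMix (K+B)• W• = Kₛₜ −` (the 27 terms) — the exact second-order Ward-failure price
`D_st` of F-g8-2 §1. -/
theorem deflJetMix_coframe_eq_wardFailure (K₀ Kₛ Kₜ Kₛₜ : Matrix ν ν ℝ) (T₀ Tₛ Tₜ Tₛₜ : Matrix ρ ν ℝ) (A₀ Aₛ Aₜ Aₛₜ : Matrix ρ ρ ℝ)
    (W₀ Wₛ Wₜ Wₛₜ : Matrix ν ρ ℝ) (Eₛ Eₜ Eₛₜ Fₛ Fₜ P₀ : Matrix ν ρ ℝ) (P Φₛ Φₜ Φₛₜ Zₛ Zₜ Zₛₜ : Matrix ρ ρ ℝ)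
    (hK₀ : K₀ᵀ = K₀) (hKₛ : Kₛᵀ = Kₛ) (hKₜ : Kₜᵀ = Kₜ) (hKₛₜ : Kₛₜᵀ = Kₛₜ)
    (hA₀ : A₀ᵀ = A₀) (hAₛ : Aₛᵀ = Aₛ) (hAₜ : Aₜᵀ = Aₜ) (hAₛₜ : Aₛₜᵀ = Aₛₜ) (hTW : (T₀ * W₀).det ≠ 0) (hA : A₀.det ≠ 0)
    (a0 : K₀ * W₀ = 0)
    (hEₛ : Eₛ = Kₛ * W₀ + K₀ * Wₛ) (hEₜ : Eₜ = Kₜ * W₀ + K₀ * Wₜ) (hEₛₜ : Eₛₜ = Kₛₜ * W₀ + Kₛ * Wₜ + Kₜ * Wₛ + K₀ * Wₛₜ)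
    (hFₛ : Fₛ = gram₁ T₀ Tₛ A₀ Aₛ * W₀ + gram₀ T₀ A₀ * Wₛ) (hFₜ : Fₜ = gram₁ T₀ Tₜ A₀ Aₜ * W₀ + gram₀ T₀ A₀ * Wₜ)
    (hP : P = (gram₀ W₀ (gram₀ T₀ A₀))⁻¹) (hP₀ : P₀ = gram₀ T₀ A₀ * W₀ * P)
    (hΦₛ : Φₛ = gram₁ W₀ Wₛ (gram₀ T₀ A₀) (gram₁ T₀ Tₛ A₀ Aₛ)) (hΦₜ : Φₜ = gram₁ W₀ Wₜ (gram₀ T₀ A₀) (gram₁ T₀ Tₜ A₀ Aₜ))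
    (hΦₛₜ : Φₛₜ = gramMix W₀ Wₛ Wₜ Wₛₜ (gram₀ T₀ A₀) (gram₁ T₀ Tₛ A₀ Aₛ) (gram₁ T₀ Tₜ A₀ Aₜ) (gramMix T₀ Tₛ Tₜ Tₛₜ A₀ Aₛ Aₜ Aₛₜ))
    (hZₛ : Zₛ = W₀ᵀ * Eₛ) (hZₜ : Zₜ = W₀ᵀ * Eₜ) (hZₛₜ : Zₛₜ = Wₛᵀ * Eₜ + Wₜᵀ * Eₛ + W₀ᵀ * Eₛₜ) :
    deflJetMix (K₀ + gram₀ T₀ A₀) (Kₛ + gram₁ T₀ Tₛ A₀ Aₛ) (Kₜ + gram₁ T₀ Tₜ A₀ Aₜ) (Kₛₜ + gramMix T₀ Tₛ Tₜ Tₛₜ A₀ Aₛ Aₜ Aₛₜ)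
        W₀ Wₛ Wₜ Wₛₜ
      = Kₛₜ
        - (Eₛₜ * P₀ᵀ + P₀ * Eₛₜᵀ - P₀ * Zₛₜ * P₀ᵀ)
        - (Eₛ * P * Fₜᵀ + Fₜ * P * Eₛᵀ - Eₛ * P * Φₜ * P₀ᵀ - P₀ * Φₜ * P * Eₛᵀ - Fₜ * P * Zₛ * P₀ᵀ - P₀ * Zₛ * P * Fₜᵀ
            + P₀ * Zₛ * P * Φₜ * P₀ᵀ + P₀ * Φₜ * P * Zₛ * P₀ᵀ)
        - (Fₛ * P * Eₜᵀ + Eₜ * P * Fₛᵀ - Fₛ * P * Zₜ * P₀ᵀ - P₀ * Zₜ * P * Fₛᵀ - Eₜ * P * Φₛ * P₀ᵀ - P₀ * Φₛ * P * Eₜᵀ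
            + P₀ * Φₛ * P * Zₜ * P₀ᵀ + P₀ * Zₜ * P * Φₛ * P₀ᵀ)
        - (Eₛ * P * Eₜᵀ + Eₜ * P * Eₛᵀ - Eₛ * P * Zₜ * P₀ᵀ - P₀ * Zₜ * P * Eₛᵀ - Eₜ * P * Zₛ * P₀ᵀ - P₀ * Zₛ * P * Eₜᵀ
            + P₀ * Zₛ * P * Zₜ * P₀ᵀ + P₀ * Zₜ * P * Zₛ * P₀ᵀ) := by
  have hB₀ : (gram₀ T₀ A₀)ᵀ = gram₀ T₀ A₀ := by
    simp only [gram₀, Matrix.transpose_mul, Matrix.transpose_transpose, hA₀, Matrix.mul_assoc]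
  have hBₛ : (gram₁ T₀ Tₛ A₀ Aₛ)ᵀ = gram₁ T₀ Tₛ A₀ Aₛ := gram₁_transpose_of_symm T₀ Tₛ hA₀ hAₛ
  have hBₜ : (gram₁ T₀ Tₜ A₀ Aₜ)ᵀ = gram₁ T₀ Tₜ A₀ Aₜ := gram₁_transpose_of_symm T₀ Tₜ hA₀ hAₜ
  have hBₛₜ : (gramMix T₀ Tₛ Tₜ Tₛₜ A₀ Aₛ Aₜ Aₛₜ)ᵀ = gramMix T₀ Tₛ Tₜ Tₛₜ A₀ Aₛ Aₜ Aₛₜ :=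
    gramMix_transpose_of_symm T₀ Tₛ Tₜ Tₛₜ hA₀ hAₛ hAₜ hAₛₜ
  rw [deflJetMix_add_eq_wardFailure K₀ Kₛ Kₜ Kₛₜ (gram₀ T₀ A₀) (gram₁ T₀ Tₛ A₀ Aₛ) (gram₁ T₀ Tₜ A₀ Aₜ)
    (gramMix T₀ Tₛ Tₜ Tₛₜ A₀ Aₛ Aₜ Aₛₜ) W₀ Wₛ Wₜ Wₛₜ Eₛ Eₜ Eₛₜ Fₛ Fₜ P₀ P Φₛ Φₜ Φₛₜ Zₛ Zₜ Zₛₜ hK₀ hKₛ hKₜ hKₛₜ hB₀ hBₛ hBₜ hBₛₜ a0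
    hEₛ hEₜ hEₛₜ hFₛ hFₜ hP hP₀ hΦₛ hΦₜ hΦₛₜ hZₛ hZₜ hZₛₜ,
    deflJetMix_coframe T₀ Tₛ Tₜ Tₛₜ A₀ Aₛ Aₜ Aₛₜ W₀ Wₛ Wₜ Wₛₜ hA₀ hAₛ hAₜ hAₛₜ hTW hA, add_zero]

end Summit.QuantumFields.BalabanUV.Beta.D1BFx.SliceTransferDefectWardJetMix

end
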